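import Mathlib
import Summits.Ventures.Crystal3D.Theorems.StickyWulffConstantTextureLiminfTexShadowCertificateDefs
import HarnessLib

/-!
# Line `TexShadow` for the crux `TextureLiminf` (stmt-Ventures-19483) — WALL-CELL VOCABULARY file (v6.5 §2 / §2b)

HONEST FRAMING. Part of the venture `Summits/Ventures/Crystal3D` (cell `crystal3d-full`), route
`route-Ventures-StickyWulffConstant`, crux `TextureLiminf` (stmt-Ventures-19483).  This file carries, VERBATIM (def
bodies byte-identical modulo whitespace, same namespace and names), the ONE-CELL wall vocabulary of the planner's
REGISTERED skeleton `HOME/cf-p1/route/lines/tex/TexShadow.lean` v6.5 (planner crystal3d-full-p1 gen 28, ROUTE.md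
§86(24)/(30); the `BilayerWallAt` body is wulff-p2 g12's draft `HOME/wulff-p2/g12/BilayerWallAtDraft.lean`):

* `cyl R₀ h ρ` — the clamped cylinder of a wall cell (§2);
* `innerBonds S P beyond` — the inner-face bond count of a clamped plate (§2);
* `BilayerWallAt C R₀ σ₁ σ₂ L₁ L₂ s₁ s₂ c` — the wall-cell inequality with explicit constants for ONE pair of Barlow
  plates and ONE charge table `c` (§2b), the common conclusion of the two open wall stubs `stub_bilayerWallGeneric`
  / `stub_bilayerWallResidual` and of lane G's walker ledger with per-top frames (19480-p2 CAP-START);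
* `bilayerWallAt_mono` — monotonicity in the rim constant (§2b, the lemma the planner's glue `bilayerWall_of_split`
  uses), with its proof.

so that helpers can conclude `BilayerWallAt …` BY NAME in `Theorems/` files (the T-side port of the walker ledger:
Barlow sealing, inner-face bookkeeping, flux count — cf-p1 ROUTE.md §86(23) R / §86(26) U).  Deliberately NOT here
(still planner-versioned): the charge admissibility `BilayerChargeAdmissible` (direction fixed only in v6.5), the
framing `BilayerFramesAt`, the residual class `InResidualClass` (keyed to lane G's residual of record) and the split
`BilayerWallGeneric/Residual[From]`, `BilayerWall`, `bilayerWall_of_split`.  Definitions (and one monotonicity lemma)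
only; nothing about the stubs is claimed.  WHAT THIS IS NOT: any part of the wall law; rung F-C1 not moved.
-/

open scoped BigOperators InnerProductSpace ENNReal
open MeasureTheory Filter

namespace Summit.Ventures.Crystal3D.Cruxes.TextureLiminf.TexShadow

open Summit.Ventures.Crystal3D
open Literature.MathematicalPhysics.StatisticalMechanics (fccStacking barlowStacking IsHaggSeq
  fieldDivergence HasFinitePerimeter contactDeficiency)

/-! ## §2 (part) The wall cell (verbatim from `TexShadow.lean` v6.5) -/

/-- the clamped cylinder of a wall cell: heights `[-2R₀, h + 2R₀]`, radius `ρ`, axis `e₃`. -/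
def cyl (R₀ h ρ : ℝ) : Set E3 :=
  {p | -(2 * R₀) ≤ p 2 ∧ p 2 ≤ h + 2 * R₀ ∧ p 0 ^ 2 + p 1 ^ 2 ≤ ρ ^ 2}

/-- inner-face bond count of a clamped plate `P ⊆ S`: stacking bonds from plate balls to stacking
sites beyond the plate's inner face (`½ ·` this `= φ(ν)·πρ² + O(ρ)` for an fcc plate). -/
noncomputable def innerBonds (S : Set E3) (P : Finset E3) (beyond : E3 → Prop) : ℝ :=
  ∑ p ∈ P, (({q : E3 | q ∈ S ∧ dist p q = 1 ∧ beyond q}).ncard : ℝ)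

/-! ## §2b (part) The wall cell inequality with explicit constants (verbatim from `TexShadow.lean` v6.5) -/

/-- **The wall cell inequality with explicit constants** (`C`, `R₀`) for ONE pair of Barlow plates and ONE charge table:
VERBATIM the body of `BilayerWall` after its charge hypotheses (wulff-p2 g12 draft). -/
def BilayerWallAt (C R₀ : ℝ) (σ₁ σ₂ : ℤ → ℤ) (L₁ L₂ : E3 ≃ₗᵢ[ℝ] E3) (s₁ s₂ : E3) (c : ℤ → ℤ → ℝ) : Prop :=
  ∀ h : ℝ, 0 ≤ h → ∀ ρ : ℝ, R₀ ≤ ρ → ∀ X P₁ P₂ : Finset E3,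
    (∀ p ∈ X, ∀ q ∈ X, p ≠ q → 1 ≤ dist p q) → P₁ ⊆ X → P₂ ⊆ X \ P₁ → (∀ p ∈ X, p ∈ cyl R₀ h ρ) →
    (∀ p, p ∈ P₁ ↔ (p ∈ stacking L₁ s₁ σ₁ ∧ -(2 * R₀) ≤ p 2 ∧ p 2 ≤ -R₀ ∧ p 0 ^ 2 + p 1 ^ 2 ≤ ρ ^ 2)) →
    (∀ p, p ∈ P₂ ↔ (p ∈ stacking L₂ s₂ σ₂ ∧ h + R₀ ≤ p 2 ∧ p 2 ≤ h + 2 * R₀ ∧ p 0 ^ 2 + p 1 ^ 2 ≤ ρ ^ 2)) →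
    ((((P₁ ×ˢ (X \ P₁)).filter fun pq => dist pq.1 pq.2 = 1).card : ℕ) : ℝ) +
      ((((P₂ ×ˢ ((X \ P₁) \ P₂)).filter fun pq => dist pq.1 pq.2 = 1).card : ℕ) : ℝ) ≤
      contactDeficiency ((X \ P₁) \ P₂) +
        1 / 2 * innerBonds (stacking L₁ s₁ σ₁) P₁ (fun q => -R₀ < q 2) +
        1 / 2 * innerBonds (stacking L₂ s₂ σ₂) P₂ (fun q => q 2 < h + R₀) -
        (∑' ij : ℤ × ℤ, c ij.1 ij.2 *
          (volume ({q : E3 | 0 ≤ q 2 ∧ q 2 ≤ 1 ∧ q 0 ^ 2 + q 1 ^ 2 ≤ ρ ^ 2} ∩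
            laySlab L₁ s₁ ij.1 ∩ laySlab L₂ s₂ ij.2)).toReal) +
        C * (1 + h) * ρ

/-- The cell inequality is MONOTONE in the rim constant `C` (for `R₀ ≥ 0`). -/
theorem bilayerWallAt_mono {C C' R₀ : ℝ} (hR : 0 ≤ R₀) (hCC' : C ≤ C') {σ₁ σ₂ : ℤ → ℤ}
    {L₁ L₂ : E3 ≃ₗᵢ[ℝ] E3} {s₁ s₂ : E3} {c : ℤ → ℤ → ℝ}
    (hW : BilayerWallAt C R₀ σ₁ σ₂ L₁ L₂ s₁ s₂ c) : BilayerWallAt C' R₀ σ₁ σ₂ L₁ L₂ s₁ s₂ c := by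
  intro h hh ρ hρ X P₁ P₂ hX hP₁ hP₂ hcyl hP₁def hP₂def
  have key := hW h hh ρ hρ X P₁ P₂ hX hP₁ hP₂ hcyl hP₁def hP₂def
  have hρ0 : 0 ≤ ρ := le_trans hR hρ
  have hmono : C * (1 + h) * ρ ≤ C' * (1 + h) * ρ := by
    have h1 : 0 ≤ (1 + h) * ρ := mul_nonneg (by linarith) hρ0
    nlinarith
  linarith

end Summit.Ventures.Crystal3D.Cruxes.TextureLiminf.TexShadow
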